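import Literature.IUT.HodgeArakelov.TemperedThetaMonoidsSubdagStatements
import Mathlib.GroupTheory.OrderOfElement

/-!
# [IUTchII] Prop 3.1 (i) / Cor 3.5 (ii): the junction binders `horb` and `hroots` are TRANSPORTED along the conjugation
# action that permutes the families `{θ^ι_env}_ι`, `{∞θ^ι_env}_ι` (J2) — from one label to every conjugate label
# (proof-only companion to `TemperedThetaMonoids.lean` / `TemperedThetaMonoidsSubdagStatements.lean`)

S. Mochizuki, *Inter-universal Teichmüller theory II*, kurims Dec-2020 manuscript: Prop 3.1 (i) p. 87 l. 47–53 («ι ranges over the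
inversion automorphisms of Proposition 2.2, (i) … this collection of subsets is equipped with a natural conjugation action by
`Π_X(M^Θ_*)`» — the action permutes the `ι`'s), Prop 2.2 (i) p. 66 («conjugates of inversion automorphisms are inversion
automorphisms»), Cor 3.5 (ii) p. 95 [cite: Mochizuki2012, Prop 3.1 (i) p.87]. Claim key DISPUTED (D-0012); nothing disputed is
asserted here — elementary algebra over abc-iut-L6-t2's REAL record `TemperedThetaMonoids.ThetaEnvData`. PROOF-ONLY companion
(abc-iut cell, layer L6, seat abc-iut-w5-d192 gen 3; nodes **IUTchII:Cor3.6(ii)** / IUTchII:Cor3.5(ii), sub-DAG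
`plan/L6/SUBDAG-IUTchII-Cor-36.md` row Cor-36.ii.r9: the binders `horb` («`θ^ι_env` is one `M^×_TM`-orbit») and `hroots`
(print's root condition p. 27) are discharged at the bridge record AT THE LABEL `i₀` of a Prop 2.2 (ii)′ datum — abc-iut-w4-d004
`horb_toRecord` p424713 / `hroots_toRecord` p427094; THIS FILE carries them to every label in the `Π_X(M^Θ_*)`-orbit of `i₀`).
NO definition, NO `Prop` fact.

PROVED, for any record `E`, any `g ∈ Π_X(M^Θ_*)` stabilising `M^×_TM` and any two labels with
`conj g (θ^ι_env) = θ^{ι'}_env` (resp. `conj g (∞θ^ι_env) = ∞θ^{ι'}_env`) — the componentwise content of abc-iut-w5-d169's J2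
junction `ThetaEnvData.ThetaEnvPermuted` (a THEOREM at the bridge and genuine records: abc-iut-w4-d019
`thetaEnvPermuted_toRecord` / `thetaEnvPermuted_thetaEnvRecord`):
* `horb_of_image_thetaEnv_eq` — `horb` at `ι` for `θ` ⇒ `horb` at `ι'` for `conj g θ`;
* `hroots_of_image_inftyThetaEnv_eq` — `hroots` at `ι` relative to `θ` ⇒ `hroots` at `ι'` relative to `conj g θ`;
* `conj_mem_thetaEnv_of_image_eq` — `θ ∈ θ^ι_env ⇒ conj g θ ∈ θ^{ι'}_env` (bookkeeping);
* `exists_horb_hroots_of_thetaEnvPermuted` — the `∃ ι'` form straight from `ThetaEnvPermuted`.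
HONEST FRAMING: bookkeeping; no side taken on [IUTchIII] Cor 3.12; typed ≠ proved ≠ endorsed.
-/

namespace Literature.IUT.HodgeArakelov

namespace TemperedThetaMonoids

namespace ThetaEnvData

universe u v

variable {P : Type u} [Group P] (E : ThetaEnvData.{u, v} P)

/-- Bookkeeping: if `conj g` carries `θ^ι_env` onto `θ^{ι'}_env`, it carries each `θ ∈ θ^ι_env` into `θ^{ι'}_env`.
[cite: Mochizuki2012, Prop 3.1 (i) p.87] -/
theorem conj_mem_thetaEnv_of_image_eq (g : P) {ι ι' : E.Iota} (hperm : E.conj g '' E.thetaEnv ι = E.thetaEnv ι')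
    {θ : E.H} (hθ : θ ∈ E.thetaEnv ι) : E.conj g θ ∈ E.thetaEnv ι' :=
  hperm ▸ Set.mem_image_of_mem _ hθ

/-- **`horb` is transported along J2**: if `conj g` carries `θ^ι_env` onto `θ^{ι'}_env` and stabilises `M^×_TM`, and
`θ^ι_env` is the `M^×_TM`-orbit of `θ` (`horb` at `ι`, e.g. abc-iut-w4-d004 `horb_toRecord` at the label of a Prop 2.2 (ii)′
datum), then `θ^{ι'}_env` is the `M^×_TM`-orbit of `conj g θ` (`horb` at `ι'`). ([IUTchII] Prop 3.1 (i) p. 87: the conjugation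
action permutes the `ι`'s; Cor 3.5 (ii) p. 95.) [cite: Mochizuki2012, Cor 3.5 (ii) p.95] -/
theorem horb_of_image_thetaEnv_eq (g : P) {ι ι' : E.Iota} (hperm : E.conj g '' E.thetaEnv ι = E.thetaEnv ι')
    (hunits : ∀ u ∈ E.units, E.conj g u ∈ E.units) {θ : E.H}
    (horb : ∀ θ' ∈ E.thetaEnv ι, ∃ u ∈ E.units, θ' = u * θ) :
    ∀ θ' ∈ E.thetaEnv ι', ∃ u ∈ E.units, θ' = u * E.conj g θ := by
  intro θ' hθ'
  rw [← hperm] at hθ'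
  obtain ⟨θ₀, hθ₀, rfl⟩ := hθ'
  obtain ⟨u, hu, rfl⟩ := horb θ₀ hθ₀
  exact ⟨E.conj g u, hunits u hu, by rw [map_mul]⟩

/-- **`hroots` is transported along J2**: if `conj g` carries `∞θ^ι_env` onto `∞θ^{ι'}_env` and stabilises `M^×_TM`, and every
`ϑ ∈ ∞θ^ι_env` has a positive power in `M^×_TM · θ^ℕ` (`hroots` at `ι` relative to `θ`, e.g. abc-iut-w4-d004 `hroots_toRecord`
p427094 / abc-iut-w5-d192 `hroots_toRecord_of_horb` p427541), then every `ϑ ∈ ∞θ^{ι'}_env` has a positive power in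
`M^×_TM · (conj g θ)^ℕ` (`hroots` at `ι'`). ([IUTchII] Prop 1.4 p. 27; Prop 3.1 (i) p. 87.) [cite: Mochizuki2012, Prop 3.1 (i) p.87] -/
theorem hroots_of_image_inftyThetaEnv_eq (g : P) {ι ι' : E.Iota}
    (hperm : E.conj g '' E.inftyThetaEnv ι = E.inftyThetaEnv ι') (hunits : ∀ u ∈ E.units, E.conj g u ∈ E.units) {θ : E.H}
    (hroots : ∀ ϑ ∈ E.inftyThetaEnv ι, ∃ N : ℕ, 0 < N ∧ ϑ ^ N ∈ splitMonoid E.units (Submonoid.powers θ)) :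
    ∀ ϑ ∈ E.inftyThetaEnv ι', ∃ N : ℕ, 0 < N ∧ ϑ ^ N ∈ splitMonoid E.units (Submonoid.powers (E.conj g θ)) := by
  intro ϑ hϑ
  rw [← hperm] at hϑ
  obtain ⟨ϑ₀, hϑ₀, rfl⟩ := hϑ
  obtain ⟨N, hN, hmem⟩ := hroots ϑ₀ hϑ₀
  obtain ⟨u, hu, s, hs, hus⟩ := (mem_splitMonoid_iff _ _ _).1 hmem
  obtain ⟨k, rfl⟩ := (Submonoid.mem_powers_iff _ _).1 hs
  refine ⟨N, hN, (mem_splitMonoid_iff _ _ _).2 ⟨E.conj g u, hunits u hu, E.conj g θ ^ k,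
    (Submonoid.mem_powers_iff _ _).2 ⟨k, rfl⟩, ?_⟩⟩
  rw [← map_pow, ← map_pow, ← map_mul, hus]

/-- The `∃ ι'` form straight from abc-iut-w5-d169's J2 junction `ThetaEnvPermuted` (a theorem at the records, abc-iut-w4-d019):
for every `g` stabilising `M^×_TM` and every label `ι` there is a label `ι'` — the one with `conj g (θ^ι_env) = θ^{ι'}_env`,
`conj g (∞θ^ι_env) = ∞θ^{ι'}_env` — at which `horb` and `hroots` hold for `conj g θ` as soon as they hold at `ι` for `θ`.
[cite: Mochizuki2012, Prop 3.1 (i) p.87] -/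
theorem exists_horb_hroots_of_thetaEnvPermuted (hJ2 : E.ThetaEnvPermuted) (g : P)
    (hunits : ∀ u ∈ E.units, E.conj g u ∈ E.units) (ι : E.Iota) (θ : E.H) :
    ∃ ι' : E.Iota, E.conj g '' E.thetaEnv ι = E.thetaEnv ι' ∧ E.conj g '' E.inftyThetaEnv ι = E.inftyThetaEnv ι' ∧
      ((∀ θ' ∈ E.thetaEnv ι, ∃ u ∈ E.units, θ' = u * θ) →
        ∀ θ' ∈ E.thetaEnv ι', ∃ u ∈ E.units, θ' = u * E.conj g θ) ∧
      ((∀ ϑ ∈ E.inftyThetaEnv ι, ∃ N : ℕ, 0 < N ∧ ϑ ^ N ∈ splitMonoid E.units (Submonoid.powers θ)) →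
        ∀ ϑ ∈ E.inftyThetaEnv ι', ∃ N : ℕ, 0 < N ∧ ϑ ^ N ∈ splitMonoid E.units (Submonoid.powers (E.conj g θ))) := by
  obtain ⟨ι', h1, h2⟩ := hJ2 g ι
  exact ⟨ι', h1, h2, fun horb => E.horb_of_image_thetaEnv_eq g h1 hunits horb,
    fun hroots => E.hroots_of_image_inftyThetaEnv_eq g h2 hunits hroots⟩

end ThetaEnvData

end TemperedThetaMonoids

end Literature.IUT.HodgeArakelov
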